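import Literature.MathematicalPhysics.QuantumLattice.YangMillsStressEnergy
import Literature.MathematicalPhysics.QuantumLattice.YangMillsHeatFlowGradientBochner
import Mathlib.Analysis.InnerProductSpace.Calculus
import Literature.MathematicalPhysics.QuantumLattice.YangMillsClassicalBianchiProofs
import Literature.Analysis.InnerProduct.LeviCivitaFour
import HarnessLib

/-!
# The Hodge-dual field `u = ⋆(x ∧ F)` of a connection on `ℝ⁴`: tangency and Bianchi

QuantumLattice support file (everything proved; one definition, no named facts) on the proof
path of `Literature.MathematicalPhysics.QuantumLattice.Waldron2019_yangMillsFlow_flatTorus`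
(A. Waldron, Invent. math. 217 (2019)), §4 (the `f₁`-chain). Instead of the tangential curvature
2-form `Ω` on the spheres `S_r ⊂ ℝ⁴` we work with the four `𝔸`-valued functions
`u_a(x) = ½ ∑_{b,c,d} ε_{abcd} ⟨x, e_b⟩ F(x)(e_c, e_d)` (`e` an orthonormal frame), i.e.
`u = ⋆(x ∧ F)`, which carries the same information as `Ω` (`|u|² = r² |Ω|²`, file
`HodgeDualFour`) but is acted on componentwise by the scalar angular-momentum operators. Here:

* `hodgeSec e A a` — the component `u_a`;
* `sum_inner_smul_hodgeSec_eq_zero` — **tangency** `∑ₐ ⟨x, e_a⟩ u_a(x) = 0`;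
* `sum_lc4_zsmul_eq_zero_of_cyclic` — `∑_{a,c,d} ε_{abcd} T_{acd} = 0` for `T` antisymmetric in
  the last two slots with vanishing cyclic sum (pure algebra over `Fin 4`);
* `covDeriv_smul_fun` — Leibniz rule `D_w(f φ) = (∂_w f) φ + f D_wφ` for a scalar `f`;
* `covDeriv_hodgeSec` — `D_w u_a = ½∑ ε_{abcd} (⟨w,e_b⟩ F_{cd} + ⟨x,e_b⟩ D_wF_{cd})`;
* `sum_covDeriv_hodgeSec_eq_zero` — **covariant divergence-freeness** `∑ₐ D_{e_a} u_a = 0`, from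
  the Bianchi identity (tree: `covDeriv_curvature_cyclic_holds`).

References: A. Waldron, Invent. math. 217 (2019), §4 [Waldron2019]; [folklore].
-/

noncomputable section

open scoped RealInnerProductSpace BigOperators
open Literature.Analysis.InnerProduct

namespace Literature.MathematicalPhysics.QuantumLattice

/-! ### Algebra over `Fin 4` -/

section Algebra

variable {M : Type*} [AddCommGroup M] [Module ℝ M]

/-- Real form of the symbol (for rewriting). [folklore] -/
theorem lc4_real_eq (a b c d : Fin 4) : ((lc4 a b c d : ℤ) : ℝ) =
    ((Int.sign (((b : ℤ) - a) * ((c : ℤ) - a) * ((d : ℤ) - a) * ((c : ℤ) - b) * ((d : ℤ) - b) *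
      ((d : ℤ) - c)) : ℤ) : ℝ) := rfl

/-- For `T` antisymmetric in its last two slots with vanishing cyclic sums,
`∑_{a,c,d} ε_{abcd} T_{acd} = 0` (each unordered triple contributes twice the cyclic sum).
[folklore] -/
theorem sum_lc4_smul_eq_zero_of_cyclic (T : Fin 4 → Fin 4 → Fin 4 → M)
    (hanti : ∀ a c d, T a c d = -T a d c)
    (hcyc : ∀ a c d, T a c d + T c d a + T d a c = 0) (b : Fin 4) :
    ∑ a, ∑ c, ∑ d, ((lc4 a b c d : ℤ) : ℝ) • T a c d = 0 := by
  have hself : ∀ a c, T a c c = 0 := fun a c => by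
    have h := hanti a c c
    have h2 : (2 : ℝ) • T a c c = 0 := by
      rw [two_smul]; nth_rewrite 2 [h]; exact add_neg_cancel _
    rcases smul_eq_zero.1 h2 with h3 | h3
    · norm_num at h3
    · exact h3
  have key : ∀ p q s : Fin 4, T p q s - T p s q - T q p s + T q s p + T s p q - T s q p = 0 := by
    intro p q s
    rw [hanti p s q, hanti q p s, hanti s q p]
    have h := hcyc p q s
    have : T p q s - -T p q s - -T q s p + T q s p + T s p q - -T s p q =
        (2 : ℝ) • (T p q s + T q s p + T s p q) := by
      rw [two_smul]; abel
    rw [this, h, smul_zero]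
  fin_cases b <;> simp only [Fin.sum_univ_four, lc4_real_eq] <;> norm_num [hself] <;>
    simp only [show Int.sign 12 = 1 by decide, Int.cast_one, one_smul]
  · linear_combination (norm := module) (-1 : ℝ) • key 1 2 3
  · linear_combination (norm := module) key 0 2 3
  · first
      | linear_combination (norm := module) key 0 1 3
      | linear_combination (norm := module) (-1 : ℝ) • key 0 1 3
  · linear_combination (norm := module) key 0 1 2



/-- Antisymmetric contraction vanishes: `∑_{a,b} ε_{abcd} x_a x_b (…) = 0`, in the form
`∑ₐ xₐ ∑_b ∑_c ∑_d (ε_{abcd} x_b) • G_{cd} = 0`. [folklore] -/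
theorem sum_sum_lc4_symm_eq_zero (x : Fin 4 → ℝ) (G : Fin 4 → Fin 4 → M) :
    ∑ a, x a • ∑ b, ∑ c, ∑ d, (((lc4 a b c d : ℤ) : ℝ) * x b) • G c d = 0 := by
  -- `S = −S` by exchanging `a ↔ b`
  set S : M := ∑ a, x a • ∑ b, ∑ c, ∑ d, (((lc4 a b c d : ℤ) : ℝ) * x b) • G c d with hS
  have hswap : S = -S := by
    calc S = ∑ a, ∑ b, ∑ c, ∑ d, (((lc4 a b c d : ℤ) : ℝ) * x b * x a) • G c d := by
          rw [hS]
          refine Finset.sum_congr rfl fun a _ => ?_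
          rw [Finset.smul_sum]
          refine Finset.sum_congr rfl fun b _ => ?_
          rw [Finset.smul_sum]
          refine Finset.sum_congr rfl fun c _ => ?_
          rw [Finset.smul_sum]
          refine Finset.sum_congr rfl fun d _ => ?_
          rw [smul_smul, mul_comm (x a)]
      _ = ∑ b, ∑ a, ∑ c, ∑ d, (((lc4 a b c d : ℤ) : ℝ) * x b * x a) • G c d := Finset.sum_comm
      _ = ∑ b, ∑ a, ∑ c, ∑ d, -((((lc4 b a c d : ℤ) : ℝ) * x a * x b) • G c d) := by
          refine Finset.sum_congr rfl fun b _ => Finset.sum_congr rfl fun a _ =>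
            Finset.sum_congr rfl fun c _ => Finset.sum_congr rfl fun d _ => ?_
          rw [lc4_swap₁₂ b a c d, ← neg_smul]
          push_cast
          ring_nf
      _ = -S := by
          rw [hS]
          simp only [Finset.sum_neg_distrib]
          congr 1
          refine Finset.sum_congr rfl fun b _ => ?_
          rw [Finset.smul_sum]
          refine Finset.sum_congr rfl fun a _ => ?_
          rw [Finset.smul_sum]
          refine Finset.sum_congr rfl fun c _ => ?_
          rw [Finset.smul_sum]
          refine Finset.sum_congr rfl fun d _ => ?_
          rw [smul_smul, mul_comm (x b)]
  have h2 : (2 : ℝ) • S = 0 := by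
    rw [two_smul]; nth_rewrite 2 [hswap]; exact add_neg_cancel _
  rcases smul_eq_zero.1 h2 with h3 | h3
  · norm_num at h3
  · exact h3

end Algebra

/-! ### The Hodge-dual sections -/

section Field

variable {E : Type*} [NormedAddCommGroup E] [InnerProductSpace ℝ E]
variable {𝔸 : Type*} [NormedRing 𝔸] [NormedAlgebra ℝ 𝔸]

/-- **The Hodge-dual section** `u_a(x) = ½ ∑_{b,c,d} ε_{abcd} ⟨x, e_b⟩ F(x)(e_c, e_d)`.
[folklore] -/
def hodgeSec (e : OrthonormalBasis (Fin 4) ℝ E) (A : Connection E 𝔸) (a : Fin 4) (x : E) : 𝔸 :=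
  (1 / 2 : ℝ) • ∑ b, ∑ c, ∑ d, (((lc4 a b c d : ℤ) : ℝ) * ⟪x, e b⟫) • curvature A x (e c) (e d)

/-- **Tangency**: `∑ₐ ⟨x, e_a⟩ u_a(x) = 0`. [folklore] -/
theorem sum_inner_smul_hodgeSec_eq_zero (e : OrthonormalBasis (Fin 4) ℝ E) (A : Connection E 𝔸)
    (x : E) : ∑ a, ⟪x, e a⟫ • hodgeSec e A a x = 0 := by
  unfold hodgeSec
  simp_rw [smul_comm (⟪x, e _⟫) (1 / 2 : ℝ), ← Finset.smul_sum]
  rw [sum_sum_lc4_symm_eq_zero (fun k => ⟪x, e k⟫) (fun c d => curvature A x (e c) (e d)), smul_zero]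

/-- **Leibniz rule for a scalar factor**: `D_w(f φ) = (∂_w f) φ + f D_wφ`. [folklore] -/
theorem covDeriv_smul_fun (A : Connection E 𝔸) {f : E → ℝ} {φ : E → 𝔸} {x : E}
    (hf : DifferentiableAt ℝ f x) (hφ : DifferentiableAt ℝ φ x) (w : E) :
    covDeriv A (fun y => f y • φ y) x w = (fderiv ℝ f x w) • φ x + f x • covDeriv A φ x w := by
  unfold covDeriv
  rw [fderiv_fun_smul hf hφ]
  simp only [FunLike.coe_add, Pi.add_apply, smul_apply,
    ContinuousLinearMap.smulRight_apply, Ring.lie_def, mul_smul_comm, smul_mul_assoc, smul_sub,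
    smul_add]
  abel

/-- **Covariant derivative of the Hodge-dual section** (for `A ∈ C²`):
`D_w u_a = ½ ∑ ε_{abcd} (⟨w, e_b⟩ F_{cd} + ⟨x, e_b⟩ D_w F_{cd})`. [folklore] -/
theorem covDeriv_hodgeSec (e : OrthonormalBasis (Fin 4) ℝ E) {A : Connection E 𝔸}
    (hA : ContDiff ℝ 2 A) (a : Fin 4) (x w : E) :
    covDeriv A (hodgeSec e A a) x w =
      (1 / 2 : ℝ) • ∑ b, ∑ c, ∑ d,
        ((((lc4 a b c d : ℤ) : ℝ) * ⟪w, e b⟫) • curvature A x (e c) (e d) +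
          (((lc4 a b c d : ℤ) : ℝ) * ⟪x, e b⟫) • covDeriv A (fun y => curvature A y (e c) (e d)) x w) := by
  have hA' : ContDiff ℝ ((1 : WithTop ℕ∞) + 1) A := by
    rw [show ((1 : WithTop ℕ∞) + 1) = 2 by norm_num]; exact hA
  have hF : ∀ c d, DifferentiableAt ℝ (fun y => curvature A y (e c) (e d)) x := fun c d =>
    ((contDiff_curvature_apply (k := 1) hA' (e c) (e d)).differentiable one_ne_zero) x
  have hlin : ∀ b c d, DifferentiableAt ℝ (fun y : E => ((lc4 a b c d : ℤ) : ℝ) * ⟪y, e b⟫) x :=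
    fun b c d => (differentiableAt_id.inner ℝ (differentiableAt_const (e b))).const_mul _
  have hdlin : ∀ b c d, fderiv ℝ (fun y : E => ((lc4 a b c d : ℤ) : ℝ) * ⟪y, e b⟫) x w =
      ((lc4 a b c d : ℤ) : ℝ) * ⟪w, e b⟫ := by
    intro b c d
    have h : HasFDerivAt (fun y : E => ((lc4 a b c d : ℤ) : ℝ) * ⟪y, e b⟫)
        (((lc4 a b c d : ℤ) : ℝ) • (innerSL ℝ (e b) : E →L[ℝ] ℝ)) x := by
      have h1 : HasFDerivAt (fun y : E => ⟪y, e b⟫) (innerSL ℝ (e b) : E →L[ℝ] ℝ) x := by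
        have := (innerSL ℝ (e b) : E →L[ℝ] ℝ).hasFDerivAt (x := x)
        simpa [innerSL_apply_apply, real_inner_comm] using this
      exact h1.const_mul _
    rw [h.fderiv]
    simp [innerSL_apply_apply, real_inner_comm]
  have hterm : ∀ b c d, DifferentiableAt ℝ
      (fun y : E => (((lc4 a b c d : ℤ) : ℝ) * ⟪y, e b⟫) • curvature A y (e c) (e d)) x :=
    fun b c d => (hlin b c d).smul (hF c d)
  have hsum_d : ∀ b c, DifferentiableAt ℝ (fun y : E => ∑ d,
      (((lc4 a b c d : ℤ) : ℝ) * ⟪y, e b⟫) • curvature A y (e c) (e d)) x :=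
    fun b c => by
      have := DifferentiableAt.fun_sum (u := Finset.univ) fun d _ => hterm b c d
      simpa using this
  have hsum_c : ∀ b, DifferentiableAt ℝ (fun y : E => ∑ c, ∑ d,
      (((lc4 a b c d : ℤ) : ℝ) * ⟪y, e b⟫) • curvature A y (e c) (e d)) x :=
    fun b => by
      have := DifferentiableAt.fun_sum (u := Finset.univ) fun c _ => hsum_d b c
      simpa using this
  have hsum_b : DifferentiableAt ℝ (fun y : E => ∑ b, ∑ c, ∑ d,
      (((lc4 a b c d : ℤ) : ℝ) * ⟪y, e b⟫) • curvature A y (e c) (e d)) x := by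
    have := DifferentiableAt.fun_sum (u := Finset.univ) fun b _ => hsum_c b
    simpa using this
  unfold hodgeSec
  rw [covDeriv_fun_smul A (1 / 2 : ℝ) hsum_b]
  congr 1
  rw [covDeriv_fun_sum Finset.univ A (fun b _ => hsum_c b)]
  refine Finset.sum_congr rfl fun b _ => ?_
  rw [covDeriv_fun_sum Finset.univ A (fun c _ => hsum_d b c)]
  refine Finset.sum_congr rfl fun c _ => ?_
  rw [covDeriv_fun_sum Finset.univ A (fun d _ => hterm b c d)]
  refine Finset.sum_congr rfl fun d _ => ?_
  rw [covDeriv_smul_fun A (hlin b c d) (hF c d), hdlin]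

/-- **Covariant divergence-freeness of the Hodge-dual field**: `∑ₐ D_{e_a} u_a = 0` for
`A ∈ C²` (Bianchi identity). [folklore] -/
theorem sum_covDeriv_hodgeSec_eq_zero (e : OrthonormalBasis (Fin 4) ℝ E) {A : Connection E 𝔸}
    (hA : ContDiff ℝ 2 A) (x : E) : ∑ a, covDeriv A (hodgeSec e A a) x (e a) = 0 := by
  simp_rw [covDeriv_hodgeSec e hA]
  rw [← Finset.smul_sum]
  simp_rw [Finset.sum_add_distrib]
  -- first group: `⟨e_a, e_b⟩ = δ_{ab}` and `ε_{aacd} = 0`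
  have h1 : ∑ a, ∑ b, ∑ c, ∑ d,
      (((lc4 a b c d : ℤ) : ℝ) * ⟪e a, e b⟫) • curvature A x (e c) (e d) = 0 := by
    have hon : ∀ a b, ⟪e a, e b⟫ = if a = b then (1 : ℝ) else 0 := fun a b =>
      orthonormal_iff_ite.1 e.orthonormal a b
    simp_rw [hon, mul_ite, mul_one, mul_zero, ite_smul, zero_smul]
    refine Finset.sum_eq_zero fun a _ => ?_
    rw [Finset.sum_comm]
    refine Finset.sum_eq_zero fun c _ => ?_
    rw [Finset.sum_comm]
    refine Finset.sum_eq_zero fun d _ => ?_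
    rw [Finset.sum_ite_eq, if_pos (Finset.mem_univ _), lc4_self₁₂]
    simp
  -- second group: Bianchi
  have h2 : ∑ a, ∑ b, ∑ c, ∑ d, (((lc4 a b c d : ℤ) : ℝ) * ⟪x, e b⟫) •
      covDeriv A (fun y => curvature A y (e c) (e d)) x (e a) = 0 := by
    rw [Finset.sum_comm]
    refine Finset.sum_eq_zero fun b _ => ?_
    have hT := sum_lc4_smul_eq_zero_of_cyclic
      (fun a c d => covDeriv A (fun y => curvature A y (e c) (e d)) x (e a))
      (fun a c d => by
        rw [← covDeriv_fun_neg]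
        congr 1
        funext y
        exact curvature_antisymm A y (e c) (e d))
      (fun a c d => covDeriv_curvature_cyclic_holds A hA x (e a) (e c) (e d)) b
    have heq : ∑ a, ∑ c, ∑ d, (((lc4 a b c d : ℤ) : ℝ) * ⟪x, e b⟫) •
        covDeriv A (fun y => curvature A y (e c) (e d)) x (e a) =
        ⟪x, e b⟫ • ∑ a, ∑ c, ∑ d, ((lc4 a b c d : ℤ) : ℝ) •
          covDeriv A (fun y => curvature A y (e c) (e d)) x (e a) := by
      rw [Finset.smul_sum]
      refine Finset.sum_congr rfl fun a _ => ?_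
      rw [Finset.smul_sum]
      refine Finset.sum_congr rfl fun c _ => ?_
      rw [Finset.smul_sum]
      refine Finset.sum_congr rfl fun d _ => ?_
      rw [smul_smul, mul_comm]
    rw [heq, hT, smul_zero]
  rw [h1, h2, add_zero, smul_zero]

end Field


end Literature.MathematicalPhysics.QuantumLattice
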